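import Mathlib.NumberTheory.NumberField.CMField
import Mathlib.NumberTheory.NumberField.Units.DirichletTheorem
import Mathlib.GroupTheory.FiniteAbelian.Basic
import HarnessLib

/-!
# Real units of a CM field modulo norms of units: `[(𝓞_K⁺)ˣ : N_{K/K⁺}((𝓞_K)ˣ)] < ∞`
# (Dirichlet's unit theorem; Shimura 1998 §14.3 Prop. 5 «the index `[U : U₁]` is finite»)

Topic `NumberTheory/NumberFields`; namespace `Literature.NumberTheory.NumberFields.CMUnitNorm`.  THEOREMS ONLY
(no definition, no named fact, no instance; D-0014).  Cell hodgecm-mathlib, fan B, rung B-I, route card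
`B-plan/Lines/B1TorusClassFinite.md` step (3) «UNIT NORM REPS» (discharge of g5 `Aux.finite_classGroup_printed`;
consumer: B-p01's cells argument, step (4)).  HC_CM is proved only modulo the 7 printed citations until rung 0
closes; nothing here changes that.

## The statements (any CM field `K`, `c =` complex conjugation, Mathlib `NumberField.IsCMField.unitsComplexConj K`)

Let `A := {ε ∈ (𝓞 K)ˣ | c ε = ε}` — Mathlib's `IsCMField.realUnits K` (the units coming from `(𝓞 K⁺)ˣ`;
`IsCMField.unitsComplexConj_eq_self_iff`) — and `N := {η · c η | η ∈ (𝓞 K)ˣ}`, the range of the homomorphism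
`η ↦ η · c η` (`MonoidHom.id _ * ↑(unitsComplexConj K)`), a subgroup of `A` (`mul_unitsComplexConj_mem_realUnits`).

* `finite_realUnits_quotient` / `finiteIndex_subgroupOf_realUnits`: `A ⧸ N` is finite, i.e. `N` has finite index
  in `A`.
* `exists_finset_forall_mem_realUnits` (THE FORM STEP (4) CONSUMES): `∃ E : Finset (𝓞 K)ˣ, ∀ ε ∈ A, ∃ e ∈ E,
  ∃ η, ε = e * (η * c η)`; variants with the hypothesis spelled `unitsComplexConj K ε = ε`
  (`exists_finset_forall_unitsComplexConj_eq`) or on `K` as `complexConj K ε = ε`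
  (`exists_finset_forall_complexConj_eq`), and the coercion lemma `coe_mul_unitsComplexConj`
  (`↑(η * c η) = η * complexConj K η` in `K`).

## Proof

`A² ≤ N` (for `ε ∈ A`, `ε · c ε = ε²`), `A` is a finitely generated abelian group (a subgroup of `(𝓞 K)ˣ`, which
is finitely generated by Dirichlet's unit theorem — Mathlib `Module.Finite ℤ (Additive (𝓞 K)ˣ)`), so `A ⧸ N` is
finitely generated of exponent `2`, hence finite (`CommGroup.finite_of_fg_torsion`); `E :=` a set of coset
representatives.  This is the argument of Shimura 1998 §14.3 Prop. 5 («We note that the index `[U : U₁]` is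
finite») for the group `U` of TOTALLY POSITIVE units (tree: `ComplexMultiplication.finite_posRealUnits_quotient`,
`HermitianFormClasses`), run here for all real units.

## References
* [Shimura1998] G. Shimura, *Abelian Varieties with Complex Multiplication and Modular Functions* (1998), §14.3
  Prop. 5, p. 104.
* [BorelIHES1963] A. Borel, *Some finiteness properties of adele groups over number fields*, Publ. Math. IHÉS 16
  (1963), Thm. 5.1 (the finiteness this lemma feeds, via the route card).
-/

set_option autoImplicit false

noncomputable section

open NumberField NumberField.Units NumberField.IsCMField

namespace Literature.NumberTheory.NumberFields

namespace CMUnitNorm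

variable (K : Type*) [Field K] [NumberField K] [IsCMField K]

/-! ### §1. Complex conjugation on units: bookkeeping -/

/-- `c ε` read in `K`: `↑(c ε) = complexConj K ↑ε`. [cite: Shimura1998, §14.3 Prop. 5, p. 104] -/
theorem coe_coe_unitsComplexConj (u : (𝓞 K)ˣ) :
    (((unitsComplexConj K u : (𝓞 K)ˣ) : 𝓞 K) : K) = complexConj K ((u : 𝓞 K) : K) := rfl

/-- `c (c ε) = ε` on units. [cite: Shimura1998, §14.3 Prop. 5, p. 104] -/
theorem unitsComplexConj_unitsComplexConj (u : (𝓞 K)ˣ) :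
    unitsComplexConj K (unitsComplexConj K u) = u := by
  apply Units.ext
  apply RingOfIntegers.coe_injective
  change complexConj K (complexConj K ((u : 𝓞 K) : K)) = ((u : 𝓞 K) : K)
  exact complexConj_apply_apply K _

/-- `c ε = ε` on units from `complexConj K ε = ε` in `K`. [cite: Shimura1998, §14.3 Prop. 5, p. 104] -/
theorem unitsComplexConj_eq_self_of_complexConj_eq {ε : (𝓞 K)ˣ}
    (h : complexConj K ((ε : 𝓞 K) : K) = ((ε : 𝓞 K) : K)) : unitsComplexConj K ε = ε :=
  Units.ext (RingOfIntegers.coe_injective h)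

/-- `↑(η * c η) = η * complexConj K η` in `K`. [cite: Shimura1998, §14.3 Prop. 5, p. 104] -/
theorem coe_mul_unitsComplexConj (η : (𝓞 K)ˣ) :
    (((η * unitsComplexConj K η : (𝓞 K)ˣ) : 𝓞 K) : K) =
      ((η : 𝓞 K) : K) * complexConj K ((η : 𝓞 K) : K) := by
  change algebraMap (𝓞 K) K ((η * unitsComplexConj K η : (𝓞 K)ˣ) : 𝓞 K) = _
  rw [Units.val_mul, map_mul]
  rfl

/-- **`N ≤ A`**: `η · c η` is a real unit (`c (η · c η) = c η · η`). [cite: Shimura1998, §14.3 Prop. 5, p. 104] -/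
theorem mul_unitsComplexConj_mem_realUnits (η : (𝓞 K)ˣ) : η * unitsComplexConj K η ∈ realUnits K :=
  (unitsComplexConj_eq_self_iff K _).1 (by rw [map_mul, unitsComplexConj_unitsComplexConj, mul_comm])

variable {K} in
/-- **`A² ≤ N`**: for a real unit `ε`, `ε · c ε = ε · ε`. [cite: Shimura1998, §14.3 Prop. 5, p. 104] -/
theorem mul_unitsComplexConj_eq_mul_self {ε : (𝓞 K)ˣ} (hε : ε ∈ realUnits K) :
    ε * unitsComplexConj K ε = ε * ε := by
  rw [(unitsComplexConj_eq_self_iff K ε).2 hε]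

/-- The norm homomorphism `η ↦ η · c η` on units, unfolded. [cite: Shimura1998, §14.3 Prop. 5, p. 104] -/
theorem id_mul_unitsComplexConj_apply (η : (𝓞 K)ˣ) :
    (MonoidHom.id (𝓞 K)ˣ * (unitsComplexConj K).toMonoidHom) η = η * unitsComplexConj K η := rfl

/-! ### §2. `[A : N] < ∞` -/

/-- **`A ⧸ N` is finite** (`A` = real units, `N` = norms `η · c η` of units): `A` is finitely generated
(Dirichlet) and `A ⧸ N` has exponent `2`. [cite: Shimura1998, §14.3 Prop. 5, p. 104] -/
theorem finite_realUnits_quotient :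
    Finite (realUnits K ⧸
      ((MonoidHom.id (𝓞 K)ˣ * (unitsComplexConj K).toMonoidHom).range).subgroupOf (realUnits K)) := by
  -- `A` is finitely generated: `Additive A` is a `ℤ`-submodule of the finitely generated `Additive (𝓞 K)ˣ`
  have h1 : Module.Finite ℤ (Additive (realUnits K)) :=
    Module.Finite.of_injective (MonoidHom.toAdditive (realUnits K).subtype).toIntLinearMap
      (fun x y h => Subtype.ext h)
  have h2 : Group.FG (realUnits K) := GroupFG.iff_add_fg.mpr (Module.Finite.iff_addGroup_fg.mp h1)
  -- `A ⧸ N` is finitely generated of exponent `2`: `ε² = ε · c ε ∈ N`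
  refine CommGroup.finite_of_fg_torsion _ fun x => ?_
  obtain ⟨u, rfl⟩ := QuotientGroup.mk_surjective x
  refine isOfFinOrder_iff_pow_eq_one.mpr ⟨2, two_pos, ?_⟩
  rw [pow_two, ← QuotientGroup.mk_mul, QuotientGroup.eq_one_iff, Subgroup.mem_subgroupOf]
  exact ⟨u.1, by rw [id_mul_unitsComplexConj_apply, mul_unitsComplexConj_eq_mul_self u.2]; rfl⟩

/-- **`N` has finite index in `A`** (the `Subgroup.FiniteIndex` form). [cite: Shimura1998, §14.3 Prop. 5, p. 104] -/
theorem finiteIndex_subgroupOf_realUnits :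
    (((MonoidHom.id (𝓞 K)ˣ * (unitsComplexConj K).toMonoidHom).range).subgroupOf (realUnits K)).FiniteIndex :=
  haveI := finite_realUnits_quotient K
  Subgroup.finiteIndex_of_finite_quotient

/-! ### §3. Finitely many representatives: `A = ⋃_{e ∈ E} e · N` -/

/-- **UNIT NORM REPS** (the form the cells argument consumes): there is a finite set `E` of units such that
every real unit `ε` (`ε ∈ realUnits K`, i.e. `c ε = ε`) is `e · (η · c η)` for some `e ∈ E` and some unit `η`.
[cite: Shimura1998, §14.3 Prop. 5, p. 104] -/
theorem exists_finset_forall_mem_realUnits :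
    ∃ E : Finset (𝓞 K)ˣ, ∀ ε ∈ realUnits K, ∃ e ∈ E, ∃ η : (𝓞 K)ˣ, ε = e * (η * unitsComplexConj K η) := by
  classical
  set N := ((MonoidHom.id (𝓞 K)ˣ * (unitsComplexConj K).toMonoidHom).range).subgroupOf (realUnits K)
    with hN
  haveI : Finite (realUnits K ⧸ N) := finite_realUnits_quotient K
  haveI := Fintype.ofFinite (realUnits K ⧸ N)
  refine ⟨Finset.univ.image fun q : realUnits K ⧸ N => ((q.out : realUnits K) : (𝓞 K)ˣ), fun ε hε => ?_⟩
  set a : realUnits K := ⟨ε, hε⟩ with ha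
  have h : ((QuotientGroup.mk a : realUnits K ⧸ N).out)⁻¹ * a ∈ N := by
    rw [← QuotientGroup.eq, QuotientGroup.out_eq']
  obtain ⟨η, hη⟩ := Subgroup.mem_subgroupOf.1 h
  refine ⟨_, Finset.mem_image_of_mem _ (Finset.mem_univ (QuotientGroup.mk a : realUnits K ⧸ N)), η, ?_⟩
  have hη' : η * unitsComplexConj K η =
      (((QuotientGroup.mk a : realUnits K ⧸ N).out : realUnits K) : (𝓞 K)ˣ)⁻¹ * ε := hη
  rw [hη', mul_inv_cancel_left]

/-- UNIT NORM REPS with the hypothesis `c ε = ε` on units. [cite: Shimura1998, §14.3 Prop. 5, p. 104] -/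
theorem exists_finset_forall_unitsComplexConj_eq :
    ∃ E : Finset (𝓞 K)ˣ, ∀ ε : (𝓞 K)ˣ, unitsComplexConj K ε = ε →
      ∃ e ∈ E, ∃ η : (𝓞 K)ˣ, ε = e * (η * unitsComplexConj K η) := by
  obtain ⟨E, hE⟩ := exists_finset_forall_mem_realUnits K
  exact ⟨E, fun ε hε => hE ε ((unitsComplexConj_eq_self_iff K ε).1 hε)⟩

/-- UNIT NORM REPS with the hypothesis `complexConj K ε = ε` in `K` (`c = IsCMField.complexConj K` acting on
`K`, units coerced). [cite: Shimura1998, §14.3 Prop. 5, p. 104] -/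
theorem exists_finset_forall_complexConj_eq :
    ∃ E : Finset (𝓞 K)ˣ, ∀ ε : (𝓞 K)ˣ, complexConj K ((ε : 𝓞 K) : K) = ((ε : 𝓞 K) : K) →
      ∃ e ∈ E, ∃ η : (𝓞 K)ˣ, ε = e * (η * unitsComplexConj K η) := by
  obtain ⟨E, hE⟩ := exists_finset_forall_unitsComplexConj_eq K
  exact ⟨E, fun ε hε => hE ε (unitsComplexConj_eq_self_of_complexConj_eq K hε)⟩

end CMUnitNorm

end Literature.NumberTheory.NumberFields

end
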